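import Literature.MathematicalPhysics.QuantumFieldTheory.Balaban1983to89.B1Eq324BenfattoKernelComparisonBoxes
import HarnessLib

/-!
# `Balaban1983to89.B1Eq324BenfattoKernelComparisonBounded` — [BenfattoEtAl1978] §5 (5.13) p. 155 for the class of
# [Balaban1985BackgroundPropagators] Sect. E p. 428, AT TEMPERATURE ZERO: on observables supported in a bounded-fluctuation region the
# conditioned class field is two-sidedly comparable with the product of the PLAIN Dirichlet box Gaussians, PROVED

statement-level skeleton of published theorems with citation tags; proofs where landed; nothing here is a claim about the
Yang–Mills mass gap

WHY THIS MODULE (cell `pub-ymgap`, seat `dag-n08-d` gen 12, sequel of `…KernelComparisonBoxes` («J4», p605441); node N08 [Balaban1985UV3];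
the [BenfattoEtAl1978] source chain behind the (α)-row `h324`).  Print's (5.13) p. 155 «the integral factorizes» over the boxes of a pavement
is EXACT (Markov property of the free field) and is used in BOTH directions by the §5 chain: a pavement step of the lower bound (5.11)–(5.15)
conditions on the corridor field, factorises, bounds every box integral from below, and REASSEMBLES the product into an integral against the
same conditioned measure.  At T. Bałaban's data the precision is exponentially decaying, not of finite range, and the tree's substitute is a
DOMINATION (`…ClassDecouplingExtensive.decoupling_extensive`, delivered on the conditioned class field by `…KernelComparisonExtensive` /
`…KernelComparisonBoxes`): going down uses the box Gaussians at temperature `+diag r`, coming back up those at temperature `−diag r` — so a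
chain built on it owes, box by box, a comparison between the two temperatures, which holds only on bounded-fluctuation supports.  This file
proves that comparison ONCE and at temperature ZERO: if a non-negative observable of the `Λ ∖ Γ`-coordinates vanishes unless
`Σ_y r_y (z_y − u_Γ(z̄)_y)² ≤ T` (the §5 integrands carry the small-field cut-offs `χ̂`, so they do, with `T` of the order
`b²·M₂e^{−κ′w}·#{corridor-adjacent sites near I}`), then its integral against `P̄^K_{Γ,z̄}` is within the factors `e^{±(ρ + T/2)}`,
`ρ = Σ_y r_y/(γ − r_max)`, of its integral against the product over the boxes of the plain Dirichlet box Gaussians `N(u_Γ(z̄)|_{box}, (A|_{box})⁻¹)`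
— the SAME comparison measure in both directions, no temperature to carry through the depths of the iteration, and per-box measures that are
exactly the objects of `…ClassAppendixC` / `…ClassAppendixCLemma1` / `…KernelAppendixCLemma2` / `…KernelOfPrecision` (F2–F10).  At a separating
precision (`r = 0`) the support condition is void and the constants are `1`: print's (5.13).

WHAT IS PROVED (standard axioms; no `sorry`; no definition).
* §1 GAUSSIAN CURRENCY (`ι` finite; `P₁, P₂ ≻ 0`; `Z_P = gaussZ P`): ★ `lintegral_multivariateGaussian_le_of_form_sub_le_on` /
  `lintegral_multivariateGaussian_ge_of_form_sub_le_on` — RESTRICTED-SUPPORT SANDWICH: if `F y ≠ 0 → |⟨y,P₁y⟩ − ⟨y,P₂y⟩| ≤ T` then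
  `∫⁻F dN(0,P₁⁻¹) ≤ (Z_{P₁}⁻¹Z_{P₂})·e^{T/2}·∫⁻F dN(0,P₂⁻¹)` and `(Z_{P₁}⁻¹Z_{P₂})·e^{−T/2}·∫⁻F dN(0,P₂⁻¹) ≤ ∫⁻F dN(0,P₁⁻¹)` (compare the densities
  on the support); the common-mean editions `lintegral_multivariateGaussian_mean_le/ge_of_form_sub_le_on`; and for a symmetric `γ`-coercive `B`
  with cross-row-sum bounds `r ≤ r_max < γ` along a partition `π`: `gaussZ_inv_mul_gaussZ_blockDiag_le_exp` / `exp_neg_le_gaussZ_inv_mul_gaussZ_blockDiag`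
  (`e^{−ρ} ≤ Z_B⁻¹·Z_{B_bd} ≤ e^{ρ}`, from seat n08-b's sandwich `B_bd − diag r ≤ B ≤ B_bd + diag r` and `sqrt_det_comparison_ratio_le_exp`),
  `abs_form_sub_blockDiag_le` (`|⟨x,Bx⟩ − ⟨x,B_bd x⟩| ≤ Σ_y r_y x_y²`, n08-b's `abs_form_cross_le_diag`).
* §2 ★★ `lintegral_restrict_condFieldK_le_blockDiag_of_bddFluct` / `lintegral_restrict_condFieldK_ge_blockDiag_of_bddFluct` — setting of
  `…KernelComparisonExtensive` (class kernel `hK : K x y = [x,y∈Λ]·(A⁻¹)_{xy}`, `A` symmetric `γ`-coercive on `Λ`, `Γ ⊆ Λ`, `π`, `r`): for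
  measurable `F ≥ 0` of the `Λ ∖ Γ`-coordinates with `F v ≠ 0 → Σ_y r_y (v_y − u_Γ(z̄)_y)² ≤ T` and ANY PSD kernel `K₂` with
  `covGram K₂ (Λ∖Γ) = ((A|_{Λ∖Γ})_bd)⁻¹`: `∫⁻ F dP̄^K_{Γ,z̄} ≤ e^{ρ+T/2} ∫⁻ F d[𝒩(0,K₂)∘(u_Γ(z̄)+·)⁻¹]` and
  `e^{−(ρ+T/2)} ∫⁻ F d[𝒩(0,K₂)∘(u_Γ(z̄)+·)⁻¹] ≤ ∫⁻ F dP̄^K_{Γ,z̄}`.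
* §3 ★★★ `lintegral_prod_restrict_condFieldK_le_exp_mul_prod_dirichlet` / `exp_mul_prod_dirichlet_le_lintegral_prod_restrict_condFieldK` — THE
  CLASS (5.13) AT TEMPERATURE ZERO: with the boxes `box p = {y ∈ Λ∖Γ : π y = p}` given as `Finset`s and measurable `F_p ≥ 0` of the box fields such
  that `(∀ p, F_p(z|_{box p}) ≠ 0) → Σ_y r_y (z_y − u_Γ(z̄)_y)² ≤ T`:
  `∫⁻ Π_p F_p(z|_{box p}) dP̄^K_{Γ,z̄} ≤ e^{ρ+T/2} · Π_p ∫⁻ F_p dN(u_Γ(z̄)|_{box p}, (A|_{box p})⁻¹)` and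
  `e^{−(ρ+T/2)} · Π_p ∫⁻ F_p dN(u_Γ(z̄)|_{box p}, (A|_{box p})⁻¹) ≤ ∫⁻ Π_p F_p(z|_{box p}) dP̄^K_{Γ,z̄}`.
HONEST SCOPE.  Transport and assembly over seat n08-b's matrix estimates and the tree's Kolmogorov field; the class, the substitute for (5.13)
and the bounded-fluctuation device are OURS, not print; nothing of [Balaban1985UV3] / [Balaban1985UV2] is asserted; no generalised Basic
Lemma is stated; the §5-side port is not begun here; count-neutral for N08; nothing about d = 4, the continuum, OS axioms, a mass gap or the
Clay problem.
-/

noncomputable section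

open MeasureTheory ProbabilityTheory Finset Matrix WithLp
open scoped BigOperators Matrix NNReal ENNReal

namespace Literature.MathematicalPhysics.QuantumFieldTheory.Balaban1983to89.B1Eq324BenfattoKernelComparisonBounded

open Literature.MathematicalPhysics.QuantumFieldTheory
open Literature.MathematicalPhysics.QuantumFieldTheory.GaussianToolkit
open Literature.MathematicalPhysics.QuantumFieldTheory.Balaban1983to89.B1Eq324BenfattoLemma
open Literature.MathematicalPhysics.QuantumFieldTheory.Balaban1983to89.B1Eq324BenfattoKernelRegression
open Literature.MathematicalPhysics.QuantumFieldTheory.Balaban1983to89.B1Eq324BenfattoKernelOfPrecision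
open Literature.MathematicalPhysics.QuantumFieldTheory.Balaban1983to89.B1Eq324BenfattoKernelComparison
open Literature.MathematicalPhysics.QuantumFieldTheory.Balaban1983to89.B1Eq324BenfattoKernelComparisonBoxes
open Literature.MathematicalPhysics.QuantumFieldTheory.Balaban1983to89.B1Eq324BenfattoClassAppendixC
open Literature.MathematicalPhysics.QuantumFieldTheory.Balaban1983to89.B1Eq324BenfattoClassDecoupling
open Literature.MathematicalPhysics.QuantumFieldTheory.Balaban1983to89.B1Eq324BenfattoClassDecouplingExtensive

variable {d : ℕ}

/-! ## §1  Gaussian currency: the restricted-support sandwich and the normalisation ratio `Z_B⁻¹ Z_{B_bd}` -/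

section Gaussian

variable {ι : Type*} [Fintype ι] [DecidableEq ι]

omit [DecidableEq ι] in
/-- kernel: a form inequality orders the Gaussian weights pointwise. [folklore] -/
private theorem gaussWeight_le_of_form_le {P Q : Matrix ι ι ℝ} (h : ∀ x : ι → ℝ, x ⬝ᵥ P *ᵥ x ≤ x ⬝ᵥ Q *ᵥ x)
    (y : EuclideanSpace ℝ ι) : gaussWeight Q y ≤ gaussWeight P y := by
  simp only [gaussWeight]
  apply ENNReal.ofReal_le_ofReal
  apply Real.exp_le_exp.2
  have := h (ofLp y)
  linarith

omit [DecidableEq ι] in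
/-- kernel: a form inequality orders the normalisations. [folklore] -/
private theorem gaussZ_le_of_form_le {P Q : Matrix ι ι ℝ} (h : ∀ x : ι → ℝ, x ⬝ᵥ P *ᵥ x ≤ x ⬝ᵥ Q *ᵥ x) :
    gaussZ Q ≤ gaussZ P :=
  lintegral_mono (gaussWeight_le_of_form_le h)

/-- **RESTRICTED-SUPPORT GAUSSIAN SANDWICH, upper**: for positive definite `P₁, P₂` and a measurable `F ≥ 0` with
`F y ≠ 0 → |⟨y,P₁y⟩ − ⟨y,P₂y⟩| ≤ T`, `∫⁻F dN(0,P₁⁻¹) ≤ (Z_{P₁}⁻¹·Z_{P₂})·e^{T/2}·∫⁻F dN(0,P₂⁻¹)` — compare the densities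
`Z_P⁻¹e^{−½⟨y,Py⟩}` on the support of `F` only. [cite: HornJohnson2013, §7.1 (positive definite quadratic forms); BenfattoEtAl1978, (5.13) p.155 (class substitute; ours)] -/
theorem lintegral_multivariateGaussian_le_of_form_sub_le_on {P₁ P₂ : Matrix ι ι ℝ} (hP₁ : P₁.PosDef) (hP₂ : P₂.PosDef)
    {T : ℝ} {F : EuclideanSpace ℝ ι → ℝ≥0∞} (hF : Measurable F)
    (hsupp : ∀ y, F y ≠ 0 → |ofLp y ⬝ᵥ P₁ *ᵥ ofLp y - ofLp y ⬝ᵥ P₂ *ᵥ ofLp y| ≤ T) :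
    ∫⁻ y, F y ∂(multivariateGaussian 0 P₁⁻¹) ≤
      (gaussZ P₁)⁻¹ * gaussZ P₂ * ENNReal.ofReal (Real.exp (T / 2)) * ∫⁻ y, F y ∂(multivariateGaussian 0 P₂⁻¹) := by
  obtain ⟨-, hZ0, hZtop⟩ := multivariateGaussian_inv_eq_withDensity hP₂
  have hw : ∀ y, gaussWeight P₁ y * F y ≤ ENNReal.ofReal (Real.exp (T / 2)) * (gaussWeight P₂ y * F y) := by
    intro y
    by_cases hFy : F y = 0
    · simp only [hFy, mul_zero, le_refl]
    · have h := (abs_le.mp (hsupp y hFy)).1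
      rw [← mul_assoc, gaussWeight, gaussWeight, ← ENNReal.ofReal_mul (Real.exp_pos _).le, ← Real.exp_add]
      exact mul_le_mul_left (ENNReal.ofReal_le_ofReal (Real.exp_le_exp.2 (by linarith))) _
  have hint : ∫⁻ y, gaussWeight P₁ y * F y ≤ ENNReal.ofReal (Real.exp (T / 2)) * ∫⁻ y, gaussWeight P₂ y * F y := by
    calc ∫⁻ y, gaussWeight P₁ y * F y ≤ ∫⁻ y, ENNReal.ofReal (Real.exp (T / 2)) * (gaussWeight P₂ y * F y) := lintegral_mono hw
      _ = ENNReal.ofReal (Real.exp (T / 2)) * ∫⁻ y, gaussWeight P₂ y * F y :=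
          lintegral_const_mul' _ _ ENNReal.ofReal_ne_top
  rw [lintegral_multivariateGaussian_inv_eq hP₁ F hF, lintegral_multivariateGaussian_inv_eq hP₂ F hF]
  calc (gaussZ P₁)⁻¹ * ∫⁻ y, gaussWeight P₁ y * F y
      ≤ (gaussZ P₁)⁻¹ * (ENNReal.ofReal (Real.exp (T / 2)) * ∫⁻ y, gaussWeight P₂ y * F y) := mul_le_mul_right hint _
    _ = (gaussZ P₁)⁻¹ * (ENNReal.ofReal (Real.exp (T / 2)) * ((gaussZ P₂ * (gaussZ P₂)⁻¹) * ∫⁻ y, gaussWeight P₂ y * F y)) := by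
        rw [ENNReal.mul_inv_cancel hZ0 hZtop, one_mul]
    _ = (gaussZ P₁)⁻¹ * gaussZ P₂ * ENNReal.ofReal (Real.exp (T / 2)) * ((gaussZ P₂)⁻¹ * ∫⁻ y, gaussWeight P₂ y * F y) := by
        ring

/-- **RESTRICTED-SUPPORT GAUSSIAN SANDWICH, lower**: under the same support condition,
`(Z_{P₁}⁻¹·Z_{P₂})·e^{−T/2}·∫⁻F dN(0,P₂⁻¹) ≤ ∫⁻F dN(0,P₁⁻¹)`. [cite: HornJohnson2013, §7.1; BenfattoEtAl1978, (5.13) p.155 (class substitute; ours)] -/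
theorem lintegral_multivariateGaussian_ge_of_form_sub_le_on {P₁ P₂ : Matrix ι ι ℝ} (hP₁ : P₁.PosDef) (hP₂ : P₂.PosDef)
    {T : ℝ} {F : EuclideanSpace ℝ ι → ℝ≥0∞} (hF : Measurable F)
    (hsupp : ∀ y, F y ≠ 0 → |ofLp y ⬝ᵥ P₁ *ᵥ ofLp y - ofLp y ⬝ᵥ P₂ *ᵥ ofLp y| ≤ T) :
    (gaussZ P₁)⁻¹ * gaussZ P₂ * ENNReal.ofReal (Real.exp (-(T / 2))) * ∫⁻ y, F y ∂(multivariateGaussian 0 P₂⁻¹) ≤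
      ∫⁻ y, F y ∂(multivariateGaussian 0 P₁⁻¹) := by
  obtain ⟨-, hZ0, hZtop⟩ := multivariateGaussian_inv_eq_withDensity hP₂
  have hw : ∀ y, ENNReal.ofReal (Real.exp (-(T / 2))) * (gaussWeight P₂ y * F y) ≤ gaussWeight P₁ y * F y := by
    intro y
    by_cases hFy : F y = 0
    · simp only [hFy, mul_zero, le_refl]
    · have h := (abs_le.mp (hsupp y hFy)).2
      rw [← mul_assoc, gaussWeight, gaussWeight, ← ENNReal.ofReal_mul (Real.exp_pos _).le, ← Real.exp_add]
      exact mul_le_mul_left (ENNReal.ofReal_le_ofReal (Real.exp_le_exp.2 (by linarith))) _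
  have hint : ENNReal.ofReal (Real.exp (-(T / 2))) * ∫⁻ y, gaussWeight P₂ y * F y ≤ ∫⁻ y, gaussWeight P₁ y * F y := by
    rw [← lintegral_const_mul' _ _ ENNReal.ofReal_ne_top]
    exact lintegral_mono hw
  rw [lintegral_multivariateGaussian_inv_eq hP₁ F hF, lintegral_multivariateGaussian_inv_eq hP₂ F hF]
  calc (gaussZ P₁)⁻¹ * gaussZ P₂ * ENNReal.ofReal (Real.exp (-(T / 2))) * ((gaussZ P₂)⁻¹ * ∫⁻ y, gaussWeight P₂ y * F y)
      = (gaussZ P₁)⁻¹ * (ENNReal.ofReal (Real.exp (-(T / 2))) * ((gaussZ P₂ * (gaussZ P₂)⁻¹) * ∫⁻ y, gaussWeight P₂ y * F y)) := by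
        ring
    _ = (gaussZ P₁)⁻¹ * (ENNReal.ofReal (Real.exp (-(T / 2))) * ∫⁻ y, gaussWeight P₂ y * F y) := by
        rw [ENNReal.mul_inv_cancel hZ0 hZtop, one_mul]
    _ ≤ (gaussZ P₁)⁻¹ * ∫⁻ y, gaussWeight P₁ y * F y := mul_le_mul_right hint _

/-- **The restricted-support sandwich with a common mean, upper** (translate the observable; the support condition is read on the centred
variable). [cite: HornJohnson2013, §7.1; BenfattoEtAl1978, (5.13) p.155 (class substitute; ours)] -/
theorem lintegral_multivariateGaussian_mean_le_of_form_sub_le_on {P₁ P₂ : Matrix ι ι ℝ} (hP₁ : P₁.PosDef) (hP₂ : P₂.PosDef)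
    (mu : EuclideanSpace ℝ ι) {T : ℝ} {F : EuclideanSpace ℝ ι → ℝ≥0∞} (hF : Measurable F)
    (hsupp : ∀ y, F (mu + y) ≠ 0 → |ofLp y ⬝ᵥ P₁ *ᵥ ofLp y - ofLp y ⬝ᵥ P₂ *ᵥ ofLp y| ≤ T) :
    ∫⁻ y, F y ∂(multivariateGaussian mu P₁⁻¹) ≤
      (gaussZ P₁)⁻¹ * gaussZ P₂ * ENNReal.ofReal (Real.exp (T / 2)) * ∫⁻ y, F y ∂(multivariateGaussian mu P₂⁻¹) := by
  rw [multivariateGaussian_eq_map_add mu P₁⁻¹, multivariateGaussian_eq_map_add mu P₂⁻¹,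
    lintegral_map hF (measurable_const_add mu), lintegral_map hF (measurable_const_add mu)]
  exact lintegral_multivariateGaussian_le_of_form_sub_le_on hP₁ hP₂ (hF.comp (measurable_const_add mu)) hsupp

/-- **The restricted-support sandwich with a common mean, lower.** [cite: HornJohnson2013, §7.1; BenfattoEtAl1978, (5.13) p.155 (class substitute; ours)] -/
theorem lintegral_multivariateGaussian_mean_ge_of_form_sub_le_on {P₁ P₂ : Matrix ι ι ℝ} (hP₁ : P₁.PosDef) (hP₂ : P₂.PosDef)
    (mu : EuclideanSpace ℝ ι) {T : ℝ} {F : EuclideanSpace ℝ ι → ℝ≥0∞} (hF : Measurable F)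
    (hsupp : ∀ y, F (mu + y) ≠ 0 → |ofLp y ⬝ᵥ P₁ *ᵥ ofLp y - ofLp y ⬝ᵥ P₂ *ᵥ ofLp y| ≤ T) :
    (gaussZ P₁)⁻¹ * gaussZ P₂ * ENNReal.ofReal (Real.exp (-(T / 2))) * ∫⁻ y, F y ∂(multivariateGaussian mu P₂⁻¹) ≤
      ∫⁻ y, F y ∂(multivariateGaussian mu P₁⁻¹) := by
  rw [multivariateGaussian_eq_map_add mu P₁⁻¹, multivariateGaussian_eq_map_add mu P₂⁻¹,
    lintegral_map hF (measurable_const_add mu), lintegral_map hF (measurable_const_add mu)]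
  exact lintegral_multivariateGaussian_ge_of_form_sub_le_on hP₁ hP₂ (hF.comp (measurable_const_add mu)) hsupp

end Gaussian

section Matrix

variable {m σ : Type*} [Fintype m] [DecidableEq m] [Fintype σ] [DecidableEq σ]

omit [DecidableEq m] [Fintype σ] [DecidableEq σ] in
/-- kernel: the quadratic form as a double sum. [folklore] -/
private theorem dot_form_eq' (B : Matrix m m ℝ) (x : m → ℝ) :
    x ⬝ᵥ B *ᵥ x = ∑ y, ∑ y', B y y' * x y * x y' := by
  simp only [dotProduct, Matrix.mulVec, Finset.mul_sum]
  exact Finset.sum_congr rfl fun y _ => Finset.sum_congr rfl fun y' _ => by ring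

omit [DecidableEq m] [Fintype σ] in
/-- kernel: cross-row-sum bounds are non-negative. [folklore] -/
private theorem r_nonneg {B : Matrix m m ℝ} (π : m → σ) {r : m → ℝ}
    (hr : ∀ y, ∑ y', (if π y = π y' then (0 : ℝ) else |B y y'|) ≤ r y) (y : m) : 0 ≤ r y :=
  le_trans (Finset.sum_nonneg fun y' _ => by
    split_ifs
    · exact le_rfl
    · exact abs_nonneg _) (hr y)

omit [DecidableEq m] [Fintype σ] in
/-- **The form of a precision differs from that of its block-diagonal part by at most the diagonal form of the cross row sums**:
`|⟨x,Bx⟩ − ⟨x,B_bd x⟩| ≤ Σ_y r_y x_y²` (Schur test on the cross part: seat n08-b's `abs_form_cross_le_diag`).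
[cite: HornJohnson2013, §6.1 (Geršgorin-type row-sum bounds); BenfattoEtAl1978, (5.13) p.155 (class substitute; ours)] -/
theorem abs_form_sub_blockDiag_le {B : Matrix m m ℝ} (hB : ∀ y y', B y y' = B y' y) (π : m → σ) (r : m → ℝ)
    (hr : ∀ y, ∑ y', (if π y = π y' then (0 : ℝ) else |B y y'|) ≤ r y) (x : m → ℝ) :
    |x ⬝ᵥ B *ᵥ x - x ⬝ᵥ (Matrix.of fun y y' => if π y = π y' then B y y' else 0 : Matrix m m ℝ) *ᵥ x| ≤
      ∑ y, r y * x y ^ 2 := by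
  have hsplit := form_eq_blockDiag_add_cross B π x
  have hbd : x ⬝ᵥ (Matrix.of fun y y' => if π y = π y' then B y y' else 0 : Matrix m m ℝ) *ᵥ x =
      ∑ y, ∑ y', (if π y = π y' then B y y' else 0) * x y * x y' := by
    rw [dot_form_eq']
    rfl
  rw [dot_form_eq', hbd, hsplit, add_sub_cancel_left]
  exact abs_form_cross_le_diag hB π r hr x

/-- **The normalisation ratio `Z_B⁻¹·Z_{B_bd}` is at most `e^{ρ}`**, `ρ = Σ_y r_y/(γ − r_max)`: from the sandwich
`B_bd − diag r ≤ B ≤ B_bd + diag r` (and `B_bd − diag r ≤ B_bd ≤ B_bd + diag r`) the ratio is at most `Z_{B_bd+diag r}⁻¹·Z_{B_bd−diag r}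
= √(det(B_bd+diag r)/det(B_bd−diag r)) ≤ e^{ρ}` (seat n08-b's `gaussZ_inv_mul_gaussZ_eq`, `sqrt_det_comparison_ratio_le_exp`).
[cite: HornJohnson2013, §7.1, Cor. 7.7.4 (monotonicity of the determinant); BenfattoEtAl1978, (5.13) p.155 (class substitute; ours)] -/
theorem gaussZ_inv_mul_gaussZ_blockDiag_le_exp {B : Matrix m m ℝ} (hB : ∀ y y', B y y' = B y' y) (π : m → σ) {γ rmax : ℝ}
    (r : m → ℝ) (hγ : ∀ x : m → ℝ, γ * ∑ y, x y ^ 2 ≤ ∑ y, ∑ y', B y y' * x y * x y')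
    (hr : ∀ y, ∑ y', (if π y = π y' then (0 : ℝ) else |B y y'|) ≤ r y) (hrmax : ∀ y, r y ≤ rmax) (hγr : rmax < γ) :
    (gaussZ B)⁻¹ * gaussZ (Matrix.of fun y y' => if π y = π y' then B y y' else 0 : Matrix m m ℝ) ≤
      ENNReal.ofReal (Real.exp ((∑ y, r y) / (γ - rmax))) := by
  set Bbd : Matrix m m ℝ := Matrix.of fun y y' => if π y = π y' then B y y' else 0 with hBbd
  have hdec := decoupling_extensive hB π r hγ hr hrmax hγr (fun _ => 0) measurable_const
  have hPm : (Bbd - Matrix.diagonal r).PosDef := hdec.1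
  have hPp : (Bbd + Matrix.diagonal r).PosDef := hdec.2.1
  have hsand := hdec.2.2.1
  have hr0 : ∀ y, 0 ≤ r y := r_nonneg π hr
  have hdiag : ∀ x : m → ℝ, 0 ≤ x ⬝ᵥ Matrix.diagonal r *ᵥ x := fun x => by
    rw [dot_form_eq']
    refine Finset.sum_nonneg fun y _ => Finset.sum_nonneg fun y' _ => ?_
    by_cases h : y = y'
    · subst h
      rw [Matrix.diagonal_apply_eq]
      have := hr0 y
      have hsq : 0 ≤ x y * x y := mul_self_nonneg _
      nlinarith
    · rw [Matrix.diagonal_apply_ne _ h, zero_mul, zero_mul]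
  -- `Z_{B_bd + diag r} ≤ Z_B` and `Z_{B_bd} ≤ Z_{B_bd − diag r}`
  have hZ1 : gaussZ (Bbd + Matrix.diagonal r) ≤ gaussZ B := gaussZ_le_of_form_le fun x => (hsand x).2
  have hZ2 : gaussZ Bbd ≤ gaussZ (Bbd - Matrix.diagonal r) := gaussZ_le_of_form_le fun x => by
    rw [Matrix.sub_mulVec, dotProduct_sub]
    linarith [hdiag x]
  have hratio := (sqrt_det_comparison_ratio_le_exp hB π r hγ hr hrmax hγr).1
  calc (gaussZ B)⁻¹ * gaussZ Bbd
      ≤ (gaussZ (Bbd + Matrix.diagonal r))⁻¹ * gaussZ (Bbd - Matrix.diagonal r) :=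
        mul_le_mul' (ENNReal.inv_le_inv.2 hZ1) hZ2
    _ = ENNReal.ofReal (Real.sqrt ((Bbd + Matrix.diagonal r).det / (Bbd - Matrix.diagonal r).det)) :=
        gaussZ_inv_mul_gaussZ_eq hPm hPp
    _ ≤ ENNReal.ofReal (Real.exp ((∑ y, r y) / (γ - rmax))) := ENNReal.ofReal_le_ofReal hratio

/-- **The normalisation ratio `Z_B⁻¹·Z_{B_bd}` is at least `e^{−ρ}`.**
[cite: HornJohnson2013, §7.1, Cor. 7.7.4; BenfattoEtAl1978, (5.13) p.155 (class substitute; ours)] -/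
theorem exp_neg_le_gaussZ_inv_mul_gaussZ_blockDiag {B : Matrix m m ℝ} (hB : ∀ y y', B y y' = B y' y) (π : m → σ) {γ rmax : ℝ}
    (r : m → ℝ) (hγ : ∀ x : m → ℝ, γ * ∑ y, x y ^ 2 ≤ ∑ y, ∑ y', B y y' * x y * x y')
    (hr : ∀ y, ∑ y', (if π y = π y' then (0 : ℝ) else |B y y'|) ≤ r y) (hrmax : ∀ y, r y ≤ rmax) (hγr : rmax < γ) :
    ENNReal.ofReal (Real.exp (-((∑ y, r y) / (γ - rmax)))) ≤
      (gaussZ B)⁻¹ * gaussZ (Matrix.of fun y y' => if π y = π y' then B y y' else 0 : Matrix m m ℝ) := by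
  set Bbd : Matrix m m ℝ := Matrix.of fun y y' => if π y = π y' then B y y' else 0 with hBbd
  have hdec := decoupling_extensive hB π r hγ hr hrmax hγr (fun _ => 0) measurable_const
  have hPm : (Bbd - Matrix.diagonal r).PosDef := hdec.1
  have hPp : (Bbd + Matrix.diagonal r).PosDef := hdec.2.1
  have hsand := hdec.2.2.1
  have hr0 : ∀ y, 0 ≤ r y := r_nonneg π hr
  have hdiag : ∀ x : m → ℝ, 0 ≤ x ⬝ᵥ Matrix.diagonal r *ᵥ x := fun x => by
    rw [dot_form_eq']
    refine Finset.sum_nonneg fun y _ => Finset.sum_nonneg fun y' _ => ?_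
    by_cases h : y = y'
    · subst h
      rw [Matrix.diagonal_apply_eq]
      have := hr0 y
      have hsq : 0 ≤ x y * x y := mul_self_nonneg _
      nlinarith
    · rw [Matrix.diagonal_apply_ne _ h, zero_mul, zero_mul]
  -- `Z_B ≤ Z_{B_bd − diag r}` and `Z_{B_bd + diag r} ≤ Z_{B_bd}`
  have hZ1 : gaussZ B ≤ gaussZ (Bbd - Matrix.diagonal r) := gaussZ_le_of_form_le fun x => (hsand x).1
  have hZ2 : gaussZ (Bbd + Matrix.diagonal r) ≤ gaussZ Bbd := gaussZ_le_of_form_le fun x => by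
    rw [Matrix.add_mulVec, dotProduct_add]
    linarith [hdiag x]
  have hratio := (sqrt_det_comparison_ratio_le_exp hB π r hγ hr hrmax hγr).2
  calc ENNReal.ofReal (Real.exp (-((∑ y, r y) / (γ - rmax))))
      ≤ ENNReal.ofReal (Real.sqrt ((Bbd - Matrix.diagonal r).det / (Bbd + Matrix.diagonal r).det)) :=
        ENNReal.ofReal_le_ofReal hratio
    _ = (gaussZ (Bbd - Matrix.diagonal r))⁻¹ * gaussZ (Bbd + Matrix.diagonal r) := (gaussZ_inv_mul_gaussZ_eq hPp hPm).symm
    _ ≤ (gaussZ B)⁻¹ * gaussZ Bbd := mul_le_mul' (ENNReal.inv_le_inv.2 hZ1) hZ2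

end Matrix

/-! ## §2  The conditioned class field against the product of the plain Dirichlet box Gaussians, on bounded-fluctuation supports -/

section PrecisionClass

variable {Λ : Finset (B1Eq324BenfattoLemma.Site d)} {A : Matrix Λ Λ ℝ}
  {K : B1Eq324BenfattoLemma.Site d → B1Eq324BenfattoLemma.Site d → ℝ}
  (hK : ∀ x y, K x y = if h : x ∈ Λ ∧ y ∈ Λ then (A⁻¹ : Matrix Λ Λ ℝ) ⟨x, h.1⟩ ⟨y, h.2⟩ else 0)

include hK

/-- **TEMPERATURE-ZERO DECOUPLING ON BOUNDED-FLUCTUATION SUPPORTS, upper.**  Setting of `…KernelComparisonExtensive`: the class kernel `K` of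
a symmetric `γ`-coercive precision `A` on `Λ`, corridors `Γ ⊆ Λ`, a partition `π` of `↥(Λ ∖ Γ)`, cross-row-sum bounds
`Σ_{π y′ ≠ π y}|A_{yy′}| ≤ r_y ≤ r_max < γ`, `ρ := (Σ_y r_y)/(γ − r_max)`, and ANY positive-semidefinite kernel `K₂` whose Gram matrix on `Λ ∖ Γ` is
`((A|_{Λ∖Γ})_bd)⁻¹` — the inverse of the box-block-diagonal part, NO temperature.  If the measurable `F ≥ 0` of the `Λ ∖ Γ`-coordinates vanishes
unless `Σ_y r_y (v_y − u_Γ(z̄)_y)² ≤ T`, then `∫⁻ F dP̄^K_{Γ,z̄} ≤ e^{ρ + T/2} ∫⁻ F d[𝒩(0,K₂) ∘ (u_Γ(z̄) + ·)⁻¹]`.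
[cite: BenfattoEtAl1978, §5 (5.13) p.155, (5.36) p.159 (class substitute at temperature zero; ours)] -/
theorem lintegral_restrict_condFieldK_le_blockDiag_of_bddFluct {σ : Type*} [Fintype σ] [DecidableEq σ]
    (hAs : ∀ e e', A e e' = A e' e) {γ rmax : ℝ} (hγ0 : 0 < γ)
    (hγ : ∀ x : Λ → ℝ, γ * ∑ e, x e ^ 2 ≤ ∑ e, ∑ e', A e e' * x e * x e')
    {Γ : Finset (B1Eq324BenfattoLemma.Site d)} (hΓ : Γ ⊆ Λ) (π : ↥(Λ \ Γ) → σ) (r : ↥(Λ \ Γ) → ℝ)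
    (hr : ∀ y : ↥(Λ \ Γ), ∑ y' : ↥(Λ \ Γ), (if π y = π y' then (0 : ℝ) else
      |A ⟨y, (Finset.mem_sdiff.mp y.2).1⟩ ⟨y', (Finset.mem_sdiff.mp y'.2).1⟩|) ≤ r y)
    (hrmax : ∀ y, r y ≤ rmax) (hγr : rmax < γ) (zbar : B1Eq324BenfattoLemma.Site d → ℝ)
    {K₂ : B1Eq324BenfattoLemma.Site d → B1Eq324BenfattoLemma.Site d → ℝ} (hK₂ : IsPosSemidefKernel K₂)
    (h₂ : covGram K₂ (Λ \ Γ) = (Matrix.of fun y y' : ↥(Λ \ Γ) => if π y = π y' then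
        A ⟨y, (Finset.mem_sdiff.mp y.2).1⟩ ⟨y', (Finset.mem_sdiff.mp y'.2).1⟩ else 0)⁻¹)
    {T : ℝ} {F : (↥(Λ \ Γ) → ℝ) → ℝ≥0∞} (hF : Measurable F)
    (hsupp : ∀ v : ↥(Λ \ Γ) → ℝ, F v ≠ 0 →
      ∑ y : ↥(Λ \ Γ), r y * (v y - condMean K Γ zbar (y : B1Eq324BenfattoLemma.Site d)) ^ 2 ≤ T) :
    ∫⁻ z, F ((Λ \ Γ).restrict z) ∂((gaussianFieldOfKernel (condCov K Γ)).map
        fun (ζ : B1Eq324BenfattoLemma.Site d → ℝ) (x : B1Eq324BenfattoLemma.Site d) => condMean K Γ zbar x + ζ x) ≤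
      ENNReal.ofReal (Real.exp ((∑ y, r y) / (γ - rmax) + T / 2)) *
        ∫⁻ z, F ((Λ \ Γ).restrict z) ∂((gaussianFieldOfKernel K₂).map
          fun (ζ : B1Eq324BenfattoLemma.Site d → ℝ) (x : B1Eq324BenfattoLemma.Site d) => condMean K Γ zbar x + ζ x) := by
  classical
  set B : Matrix ↥(Λ \ Γ) ↥(Λ \ Γ) ℝ := A.submatrix (fun j : ↥(Λ \ Γ) => (⟨j, (Finset.mem_sdiff.mp j.2).1⟩ : Λ))
    (fun j : ↥(Λ \ Γ) => (⟨j, (Finset.mem_sdiff.mp j.2).1⟩ : Λ)) with hB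
  have hBs : ∀ y y', B y y' = B y' y := fun y y' => hAs _ _
  have hBγ : ∀ v : ↥(Λ \ Γ) → ℝ, γ * ∑ y, v y ^ 2 ≤ ∑ y, ∑ y', B y y' * v y * v y' := coercive_submatrix_sdiff hγ Γ
  have hrB : ∀ y : ↥(Λ \ Γ), ∑ y' : ↥(Λ \ Γ), (if π y = π y' then (0 : ℝ) else |B y y'|) ≤ r y := fun y => by
    simpa only [hB, Matrix.submatrix_apply] using hr y
  have hA : A.PosDef := posDef_of_coercive hAs hγ0 hγ
  have hBPD : B.PosDef := posDef_of_coercive hBs hγ0 hBγ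
  have hBbdPD : (Matrix.of fun y y' : ↥(Λ \ Γ) => if π y = π y' then B y y' else 0 : Matrix ↥(Λ \ Γ) ↥(Λ \ Γ) ℝ).PosDef :=
    posDef_blockDiag hBs π hγ0 hBγ
  have hdetΓ : IsUnit (covGram K Γ).det := isUnit_det_covGram_kernel hK hA hΓ
  have hKc : IsPosSemidefKernel (condCov K Γ) := isPosSemidefKernel_condCov K (isPosSemidefKernel_kernel hK hA) Γ hdetΓ
  have h₁ : covGram (condCov K Γ) (Λ \ Γ) = B⁻¹ := covGram_condCov_kernel_eq_inv_submatrix hK hA hΓ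
  have hBbd : (Matrix.of fun y y' : ↥(Λ \ Γ) => if π y = π y' then
        A ⟨y, (Finset.mem_sdiff.mp y.2).1⟩ ⟨y', (Finset.mem_sdiff.mp y'.2).1⟩ else 0) =
      (Matrix.of fun y y' : ↥(Λ \ Γ) => if π y = π y' then B y y' else 0 : Matrix ↥(Λ \ Γ) ↥(Λ \ Γ) ℝ) := by
    ext y y'
    simp only [Matrix.of_apply, hB, Matrix.submatrix_apply]
  rw [hBbd] at h₂
  have hofLp : Measurable (ofLp : EuclideanSpace ℝ ↥(Λ \ Γ) → (↥(Λ \ Γ) → ℝ)) :=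
    (MeasurableEquiv.toLp 2 (↥(Λ \ Γ) → ℝ)).symm.measurable
  -- the support condition, read on the centred Euclidean variable
  have hsupp' : ∀ y : EuclideanSpace ℝ ↥(Λ \ Γ),
      F (ofLp (toLp 2 ((Λ \ Γ).restrict (condMean K Γ zbar)) + y)) ≠ 0 →
        |ofLp y ⬝ᵥ B *ᵥ ofLp y -
          ofLp y ⬝ᵥ (Matrix.of fun y y' : ↥(Λ \ Γ) => if π y = π y' then B y y' else 0 : Matrix ↥(Λ \ Γ) ↥(Λ \ Γ) ℝ) *ᵥ ofLp y| ≤ T := by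
    intro y hy
    have hT := hsupp _ hy
    have hx : ∀ a : ↥(Λ \ Γ), (ofLp (toLp 2 ((Λ \ Γ).restrict (condMean K Γ zbar)) + y)) a -
        condMean K Γ zbar (a : B1Eq324BenfattoLemma.Site d) = (ofLp y) a := fun a => by
      simp only [WithLp.ofLp_add, Pi.add_apply]
      have : ((Λ \ Γ).restrict (condMean K Γ zbar)) a = condMean K Γ zbar (a : B1Eq324BenfattoLemma.Site d) := rfl
      rw [this]
      ring
    simp only [hx] at hT
    exact (abs_form_sub_blockDiag_le hBs π r hrB (ofLp y)).trans hT
  have hconst : (gaussZ B)⁻¹ * gaussZ (Matrix.of fun y y' : ↥(Λ \ Γ) => if π y = π y' then B y y' else 0 : Matrix ↥(Λ \ Γ) ↥(Λ \ Γ) ℝ) *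
      ENNReal.ofReal (Real.exp (T / 2)) ≤ ENNReal.ofReal (Real.exp ((∑ y, r y) / (γ - rmax) + T / 2)) := by
    rw [Real.exp_add, ENNReal.ofReal_mul (Real.exp_pos _).le]
    exact mul_le_mul_left (gaussZ_inv_mul_gaussZ_blockDiag_le_exp hBs π r hBγ hrB hrmax hγr) _
  rw [lintegral_comp_restrict_shift_eq hKc (condMean K Γ zbar) (Λ \ Γ) hF,
    lintegral_comp_restrict_shift_eq hK₂ (condMean K Γ zbar) (Λ \ Γ) hF, h₁, h₂]
  exact (lintegral_multivariateGaussian_mean_le_of_form_sub_le_on hBPD hBbdPD _ (hF.comp hofLp) hsupp').trans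
    (mul_le_mul_left hconst _)

/-- **TEMPERATURE-ZERO DECOUPLING ON BOUNDED-FLUCTUATION SUPPORTS, lower**: with the same data,
`e^{−(ρ + T/2)} ∫⁻ F d[𝒩(0,K₂) ∘ (u_Γ(z̄) + ·)⁻¹] ≤ ∫⁻ F dP̄^K_{Γ,z̄}`.
[cite: BenfattoEtAl1978, §5 (5.13) p.155, (5.15) p.155 (class substitute at temperature zero; ours)] -/
theorem lintegral_restrict_condFieldK_ge_blockDiag_of_bddFluct {σ : Type*} [Fintype σ] [DecidableEq σ]
    (hAs : ∀ e e', A e e' = A e' e) {γ rmax : ℝ} (hγ0 : 0 < γ)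
    (hγ : ∀ x : Λ → ℝ, γ * ∑ e, x e ^ 2 ≤ ∑ e, ∑ e', A e e' * x e * x e')
    {Γ : Finset (B1Eq324BenfattoLemma.Site d)} (hΓ : Γ ⊆ Λ) (π : ↥(Λ \ Γ) → σ) (r : ↥(Λ \ Γ) → ℝ)
    (hr : ∀ y : ↥(Λ \ Γ), ∑ y' : ↥(Λ \ Γ), (if π y = π y' then (0 : ℝ) else
      |A ⟨y, (Finset.mem_sdiff.mp y.2).1⟩ ⟨y', (Finset.mem_sdiff.mp y'.2).1⟩|) ≤ r y)
    (hrmax : ∀ y, r y ≤ rmax) (hγr : rmax < γ) (zbar : B1Eq324BenfattoLemma.Site d → ℝ)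
    {K₂ : B1Eq324BenfattoLemma.Site d → B1Eq324BenfattoLemma.Site d → ℝ} (hK₂ : IsPosSemidefKernel K₂)
    (h₂ : covGram K₂ (Λ \ Γ) = (Matrix.of fun y y' : ↥(Λ \ Γ) => if π y = π y' then
        A ⟨y, (Finset.mem_sdiff.mp y.2).1⟩ ⟨y', (Finset.mem_sdiff.mp y'.2).1⟩ else 0)⁻¹)
    {T : ℝ} {F : (↥(Λ \ Γ) → ℝ) → ℝ≥0∞} (hF : Measurable F)
    (hsupp : ∀ v : ↥(Λ \ Γ) → ℝ, F v ≠ 0 →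
      ∑ y : ↥(Λ \ Γ), r y * (v y - condMean K Γ zbar (y : B1Eq324BenfattoLemma.Site d)) ^ 2 ≤ T) :
    ENNReal.ofReal (Real.exp (-((∑ y, r y) / (γ - rmax) + T / 2))) *
        ∫⁻ z, F ((Λ \ Γ).restrict z) ∂((gaussianFieldOfKernel K₂).map
          fun (ζ : B1Eq324BenfattoLemma.Site d → ℝ) (x : B1Eq324BenfattoLemma.Site d) => condMean K Γ zbar x + ζ x) ≤
      ∫⁻ z, F ((Λ \ Γ).restrict z) ∂((gaussianFieldOfKernel (condCov K Γ)).map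
        fun (ζ : B1Eq324BenfattoLemma.Site d → ℝ) (x : B1Eq324BenfattoLemma.Site d) => condMean K Γ zbar x + ζ x) := by
  classical
  set B : Matrix ↥(Λ \ Γ) ↥(Λ \ Γ) ℝ := A.submatrix (fun j : ↥(Λ \ Γ) => (⟨j, (Finset.mem_sdiff.mp j.2).1⟩ : Λ))
    (fun j : ↥(Λ \ Γ) => (⟨j, (Finset.mem_sdiff.mp j.2).1⟩ : Λ)) with hB
  have hBs : ∀ y y', B y y' = B y' y := fun y y' => hAs _ _
  have hBγ : ∀ v : ↥(Λ \ Γ) → ℝ, γ * ∑ y, v y ^ 2 ≤ ∑ y, ∑ y', B y y' * v y * v y' := coercive_submatrix_sdiff hγ Γ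
  have hrB : ∀ y : ↥(Λ \ Γ), ∑ y' : ↥(Λ \ Γ), (if π y = π y' then (0 : ℝ) else |B y y'|) ≤ r y := fun y => by
    simpa only [hB, Matrix.submatrix_apply] using hr y
  have hA : A.PosDef := posDef_of_coercive hAs hγ0 hγ
  have hBPD : B.PosDef := posDef_of_coercive hBs hγ0 hBγ
  have hBbdPD : (Matrix.of fun y y' : ↥(Λ \ Γ) => if π y = π y' then B y y' else 0 : Matrix ↥(Λ \ Γ) ↥(Λ \ Γ) ℝ).PosDef :=
    posDef_blockDiag hBs π hγ0 hBγ
  have hdetΓ : IsUnit (covGram K Γ).det := isUnit_det_covGram_kernel hK hA hΓ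
  have hKc : IsPosSemidefKernel (condCov K Γ) := isPosSemidefKernel_condCov K (isPosSemidefKernel_kernel hK hA) Γ hdetΓ
  have h₁ : covGram (condCov K Γ) (Λ \ Γ) = B⁻¹ := covGram_condCov_kernel_eq_inv_submatrix hK hA hΓ
  have hBbd : (Matrix.of fun y y' : ↥(Λ \ Γ) => if π y = π y' then
        A ⟨y, (Finset.mem_sdiff.mp y.2).1⟩ ⟨y', (Finset.mem_sdiff.mp y'.2).1⟩ else 0) =
      (Matrix.of fun y y' : ↥(Λ \ Γ) => if π y = π y' then B y y' else 0 : Matrix ↥(Λ \ Γ) ↥(Λ \ Γ) ℝ) := by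
    ext y y'
    simp only [Matrix.of_apply, hB, Matrix.submatrix_apply]
  rw [hBbd] at h₂
  have hofLp : Measurable (ofLp : EuclideanSpace ℝ ↥(Λ \ Γ) → (↥(Λ \ Γ) → ℝ)) :=
    (MeasurableEquiv.toLp 2 (↥(Λ \ Γ) → ℝ)).symm.measurable
  have hsupp' : ∀ y : EuclideanSpace ℝ ↥(Λ \ Γ),
      F (ofLp (toLp 2 ((Λ \ Γ).restrict (condMean K Γ zbar)) + y)) ≠ 0 →
        |ofLp y ⬝ᵥ B *ᵥ ofLp y -
          ofLp y ⬝ᵥ (Matrix.of fun y y' : ↥(Λ \ Γ) => if π y = π y' then B y y' else 0 : Matrix ↥(Λ \ Γ) ↥(Λ \ Γ) ℝ) *ᵥ ofLp y| ≤ T := by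
    intro y hy
    have hT := hsupp _ hy
    have hx : ∀ a : ↥(Λ \ Γ), (ofLp (toLp 2 ((Λ \ Γ).restrict (condMean K Γ zbar)) + y)) a -
        condMean K Γ zbar (a : B1Eq324BenfattoLemma.Site d) = (ofLp y) a := fun a => by
      simp only [WithLp.ofLp_add, Pi.add_apply]
      have : ((Λ \ Γ).restrict (condMean K Γ zbar)) a = condMean K Γ zbar (a : B1Eq324BenfattoLemma.Site d) := rfl
      rw [this]
      ring
    simp only [hx] at hT
    exact (abs_form_sub_blockDiag_le hBs π r hrB (ofLp y)).trans hT
  have hconst : ENNReal.ofReal (Real.exp (-((∑ y, r y) / (γ - rmax) + T / 2))) ≤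
      (gaussZ B)⁻¹ * gaussZ (Matrix.of fun y y' : ↥(Λ \ Γ) => if π y = π y' then B y y' else 0 : Matrix ↥(Λ \ Γ) ↥(Λ \ Γ) ℝ) *
        ENNReal.ofReal (Real.exp (-(T / 2))) := by
    rw [neg_add, Real.exp_add, ENNReal.ofReal_mul (Real.exp_pos _).le]
    exact mul_le_mul_left (exp_neg_le_gaussZ_inv_mul_gaussZ_blockDiag hBs π r hBγ hrB hrmax hγr) _
  rw [lintegral_comp_restrict_shift_eq hKc (condMean K Γ zbar) (Λ \ Γ) hF,
    lintegral_comp_restrict_shift_eq hK₂ (condMean K Γ zbar) (Λ \ Γ) hF, h₁, h₂]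
  exact (mul_le_mul_left hconst _).trans
    (lintegral_multivariateGaussian_mean_ge_of_form_sub_le_on hBPD hBbdPD _ (hF.comp hofLp) hsupp')

end PrecisionClass

/-! ## §3  The class (5.13) at temperature zero: the product of the plain Dirichlet box Gaussians -/

section Boxes

variable {Λ : Finset (B1Eq324BenfattoLemma.Site d)} {A : Matrix Λ Λ ℝ}

/-- kernel: the block-diagonal part has no entries across the parts. [folklore] -/
private theorem blockDiag_apply_eq_zero_of_ne {σ : Type*} [DecidableEq σ] {Γ : Finset (B1Eq324BenfattoLemma.Site d)}
    (π : ↥(Λ \ Γ) → σ) :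
    ∀ y y' : ↥(Λ \ Γ), π y ≠ π y' →
      (Matrix.of fun y y' : ↥(Λ \ Γ) => if π y = π y' then
          A ⟨y, (Finset.mem_sdiff.mp y.2).1⟩ ⟨y', (Finset.mem_sdiff.mp y'.2).1⟩ else 0) y y' = 0 := by
  intro y y' h
  rw [Matrix.of_apply, if_neg h]

/-- kernel: a box is a saturated window. [folklore] -/
private theorem saturated_of_box' {σ : Type*} {Γ : Finset (B1Eq324BenfattoLemma.Site d)} (π : ↥(Λ \ Γ) → σ) (p : σ)
    {I : Finset (B1Eq324BenfattoLemma.Site d)} (hbox : ∀ y : ↥(Λ \ Γ), (y : B1Eq324BenfattoLemma.Site d) ∈ I ↔ π y = p) :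
    ∀ y y' : ↥(Λ \ Γ), (y : B1Eq324BenfattoLemma.Site d) ∈ I → π y' = π y → (y' : B1Eq324BenfattoLemma.Site d) ∈ I :=
  fun y y' hy hyy' => (hbox y').mpr (hyy'.trans ((hbox y).mp hy))

/-- **The box block of the block-diagonal part is the Dirichlet box precision `A|_{box}`** (the temperature-zero edition of
`…KernelComparisonBoxes.comparisonPrecision_submatrix_box_eq`). [cite: BenfattoEtAl1978, §5 (5.13) p.155 (class substitute; ours)] -/
theorem blockDiag_submatrix_box_eq {σ : Type*} [DecidableEq σ] {Γ : Finset (B1Eq324BenfattoLemma.Site d)} (π : ↥(Λ \ Γ) → σ)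
    (p : σ) {I : Finset (B1Eq324BenfattoLemma.Site d)} (hI : I ⊆ Λ \ Γ)
    (hbox : ∀ y : ↥(Λ \ Γ), (y : B1Eq324BenfattoLemma.Site d) ∈ I ↔ π y = p) :
    (Matrix.of fun y y' : ↥(Λ \ Γ) => if π y = π y' then
          A ⟨y, (Finset.mem_sdiff.mp y.2).1⟩ ⟨y', (Finset.mem_sdiff.mp y'.2).1⟩ else 0).submatrix
        (fun j : ↥I => (⟨j, hI j.2⟩ : ↥(Λ \ Γ))) (fun j : ↥I => (⟨j, hI j.2⟩ : ↥(Λ \ Γ))) =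
      A.submatrix (fun j : ↥I => (⟨j, (Finset.mem_sdiff.mp (hI j.2)).1⟩ : Λ))
          (fun j : ↥I => (⟨j, (Finset.mem_sdiff.mp (hI j.2)).1⟩ : Λ)) := by
  have h := comparisonPrecision_submatrix_box_eq (A := A) π (fun _ => (0 : ℝ)) 0 p hI hbox
  rw [zero_smul, add_zero, zero_smul, add_zero] at h
  exact h

variable {K : B1Eq324BenfattoLemma.Site d → B1Eq324BenfattoLemma.Site d → ℝ}
  (hK : ∀ x y, K x y = if h : x ∈ Λ ∧ y ∈ Λ then (A⁻¹ : Matrix Λ Λ ℝ) ⟨x, h.1⟩ ⟨y, h.2⟩ else 0)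

include hK

/-- **THE CLASS (5.13) AT TEMPERATURE ZERO, upper.**  Setting: the class kernel `K` of a symmetric `γ`-coercive `A` on `Λ`; corridors
`Γ ⊆ Λ`; a partition `π` of `↥(Λ ∖ Γ)` with parts `box p = {y ∈ Λ ∖ Γ : π y = p}` given as `Q₀`-windows; cross-row-sum bounds
`Σ_{π y′ ≠ π y}|A_{yy′}| ≤ r_y ≤ r_max < γ`; `ρ := (Σ_y r_y)/(γ − r_max)`; and measurable `F_p ≥ 0` of the box fields whose product is
supported in the bounded-fluctuation region `Σ_y r_y (z_y − u_Γ(z̄)_y)² ≤ T`.  Then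
`∫⁻ Π_p F_p(z|_{box p}) dP̄^K_{Γ,z̄} ≤ e^{ρ+T/2} · Π_p ∫⁻ F_p dN(u_Γ(z̄)|_{box p}, (A|_{box p})⁻¹)` — §2 at the zero-extended kernel of
`((A|_{Λ∖Γ})_bd)⁻¹`, independence of the box fields under it (`…KernelComparison.iIndepFun_shift_of_kernel_eq_zero`,
`…KernelComparison.kernel_blockDiag_eq_zero_of_ne`), Mathlib's `lintegral_prod_eq_prod_lintegral_of_indepFun`, and the window law
`…KernelComparisonBoxes.lintegral_comp_restrict_shift_window_eq`.  The free-field statement replaced is `…Sect5Eq515.integral_boxes_factorise_eq`.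
[cite: BenfattoEtAl1978, §5 (5.13) p.155, (5.36) p.159, p.153 «factorize “over the boxes □”» (class substitute at temperature zero; ours)] -/
theorem lintegral_prod_restrict_condFieldK_le_exp_mul_prod_dirichlet {σ : Type*} [Fintype σ] [DecidableEq σ]
    (hAs : ∀ e e', A e e' = A e' e) {γ rmax : ℝ} (hγ0 : 0 < γ)
    (hγ : ∀ x : Λ → ℝ, γ * ∑ e, x e ^ 2 ≤ ∑ e, ∑ e', A e e' * x e * x e')
    {Γ : Finset (B1Eq324BenfattoLemma.Site d)} (hΓ : Γ ⊆ Λ) (π : ↥(Λ \ Γ) → σ) (r : ↥(Λ \ Γ) → ℝ)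
    (hr : ∀ y : ↥(Λ \ Γ), ∑ y' : ↥(Λ \ Γ), (if π y = π y' then (0 : ℝ) else
      |A ⟨y, (Finset.mem_sdiff.mp y.2).1⟩ ⟨y', (Finset.mem_sdiff.mp y'.2).1⟩|) ≤ r y)
    (hrmax : ∀ y, r y ≤ rmax) (hγr : rmax < γ) (zbar : B1Eq324BenfattoLemma.Site d → ℝ)
    (box : σ → Finset (B1Eq324BenfattoLemma.Site d)) (hboxsub : ∀ p, box p ⊆ Λ \ Γ)
    (hbox : ∀ p (y : ↥(Λ \ Γ)), (y : B1Eq324BenfattoLemma.Site d) ∈ box p ↔ π y = p)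
    {F : (p : σ) → (↥(box p) → ℝ) → ℝ≥0∞} (hF : ∀ p, Measurable (F p)) {T : ℝ}
    (hsupp : ∀ z : B1Eq324BenfattoLemma.Site d → ℝ, (∀ p, F p ((box p).restrict z) ≠ 0) →
      ∑ y : ↥(Λ \ Γ), r y * (z y - condMean K Γ zbar y) ^ 2 ≤ T) :
    ∫⁻ z, ∏ p, F p ((box p).restrict z) ∂((gaussianFieldOfKernel (condCov K Γ)).map
        fun (ζ : B1Eq324BenfattoLemma.Site d → ℝ) (x : B1Eq324BenfattoLemma.Site d) => condMean K Γ zbar x + ζ x) ≤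
      ENNReal.ofReal (Real.exp ((∑ y, r y) / (γ - rmax) + T / 2)) *
        ∏ p, ∫⁻ y, F p (ofLp y) ∂multivariateGaussian (toLp 2 ((box p).restrict (condMean K Γ zbar)))
          (A.submatrix (fun j : ↥(box p) => (⟨j, (Finset.mem_sdiff.mp (hboxsub p j.2)).1⟩ : Λ))
              (fun j : ↥(box p) => (⟨j, (Finset.mem_sdiff.mp (hboxsub p j.2)).1⟩ : Λ)))⁻¹ := by
  classical
  -- the conditional precision and its block-diagonal part
  set B : Matrix ↥(Λ \ Γ) ↥(Λ \ Γ) ℝ := A.submatrix (fun j : ↥(Λ \ Γ) => (⟨j, (Finset.mem_sdiff.mp j.2).1⟩ : Λ))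
    (fun j : ↥(Λ \ Γ) => (⟨j, (Finset.mem_sdiff.mp j.2).1⟩ : Λ)) with hB
  have hBs : ∀ y y', B y y' = B y' y := fun y y' => hAs _ _
  have hBγ : ∀ v : ↥(Λ \ Γ) → ℝ, γ * ∑ y, v y ^ 2 ≤ ∑ y, ∑ y', B y y' * v y * v y' := coercive_submatrix_sdiff hγ Γ
  have hBbd : (Matrix.of fun y y' : ↥(Λ \ Γ) => if π y = π y' then
        A ⟨y, (Finset.mem_sdiff.mp y.2).1⟩ ⟨y', (Finset.mem_sdiff.mp y'.2).1⟩ else 0) =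
      (Matrix.of fun y y' : ↥(Λ \ Γ) => if π y = π y' then B y y' else 0 : Matrix ↥(Λ \ Γ) ↥(Λ \ Γ) ℝ) := by
    ext y y'
    simp only [Matrix.of_apply, hB, Matrix.submatrix_apply]
  have hPD : (Matrix.of fun y y' : ↥(Λ \ Γ) => if π y = π y' then
      A ⟨y, (Finset.mem_sdiff.mp y.2).1⟩ ⟨y', (Finset.mem_sdiff.mp y'.2).1⟩ else 0).PosDef := by
    rw [hBbd]
    exact posDef_blockDiag hBs π hγ0 hBγ
  -- the zero-extended comparison kernel at temperature zero (a local abbreviation of a function; no definition)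
  set K₂ : B1Eq324BenfattoLemma.Site d → B1Eq324BenfattoLemma.Site d → ℝ := fun x y =>
    if h : x ∈ Λ \ Γ ∧ y ∈ Λ \ Γ then
      (((Matrix.of fun y y' : ↥(Λ \ Γ) => if π y = π y' then
          A ⟨y, (Finset.mem_sdiff.mp y.2).1⟩ ⟨y', (Finset.mem_sdiff.mp y'.2).1⟩ else 0)⁻¹ :
        Matrix ↥(Λ \ Γ) ↥(Λ \ Γ) ℝ) ⟨x, h.1⟩ ⟨y, h.2⟩) else 0 with hK₂def
  have hK₂ : ∀ x y, K₂ x y = if h : x ∈ Λ \ Γ ∧ y ∈ Λ \ Γ then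
      (((Matrix.of fun y y' : ↥(Λ \ Γ) => if π y = π y' then
          A ⟨y, (Finset.mem_sdiff.mp y.2).1⟩ ⟨y', (Finset.mem_sdiff.mp y'.2).1⟩ else 0)⁻¹ :
        Matrix ↥(Λ \ Γ) ↥(Λ \ Γ) ℝ) ⟨x, h.1⟩ ⟨y, h.2⟩) else 0 := fun x y => rfl
  have hK₂psd : IsPosSemidefKernel K₂ := isPosSemidefKernel_kernel hK₂ hPD
  have h₂ := covGram_kernel_eq_inv hK₂
  -- Step 1: §2 for the product observable
  have hGm : Measurable (fun v : ↥(Λ \ Γ) → ℝ => ∏ p, F p (fun j : ↥(box p) => v ⟨j, hboxsub p j.2⟩)) :=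
    Finset.measurable_prod (f := fun p (v : ↥(Λ \ Γ) → ℝ) => F p (fun j : ↥(box p) => v ⟨j, hboxsub p j.2⟩)) Finset.univ
      fun p _ => (hF p).comp (measurable_pi_lambda _ fun j => measurable_pi_apply _)
  have hGsupp : ∀ v : ↥(Λ \ Γ) → ℝ, (∏ p, F p (fun j : ↥(box p) => v ⟨j, hboxsub p j.2⟩)) ≠ 0 →
      ∑ y : ↥(Λ \ Γ), r y * (v y - condMean K Γ zbar (y : B1Eq324BenfattoLemma.Site d)) ^ 2 ≤ T := by
    intro v hv
    -- extend `v` by zero to a configuration on `Q₀`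
    have hz := hsupp (fun x => if h : x ∈ Λ \ Γ then v ⟨x, h⟩ else 0) fun p => by
      have hrestr : (box p).restrict (fun x => if h : x ∈ Λ \ Γ then v ⟨x, h⟩ else 0) =
          fun j : ↥(box p) => v ⟨j, hboxsub p j.2⟩ := by
        funext j
        exact dif_pos (hboxsub p j.2)
      rw [hrestr]
      exact (Finset.prod_ne_zero_iff.mp hv) p (Finset.mem_univ p)
    have hzv : ∀ y : ↥(Λ \ Γ), (fun x => if h : x ∈ Λ \ Γ then v ⟨x, h⟩ else 0) (y : B1Eq324BenfattoLemma.Site d) = v y :=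
      fun y => by simp only [dif_pos y.2]
    simpa only [hzv] using hz
  have hdom : ∫⁻ z, ∏ p, F p ((box p).restrict z) ∂((gaussianFieldOfKernel (condCov K Γ)).map
        fun (ζ : B1Eq324BenfattoLemma.Site d → ℝ) (x : B1Eq324BenfattoLemma.Site d) => condMean K Γ zbar x + ζ x) ≤
      ENNReal.ofReal (Real.exp ((∑ y, r y) / (γ - rmax) + T / 2)) *
        ∫⁻ z, ∏ p, F p ((box p).restrict z) ∂((gaussianFieldOfKernel K₂).map
          fun (ζ : B1Eq324BenfattoLemma.Site d → ℝ) (x : B1Eq324BenfattoLemma.Site d) => condMean K Γ zbar x + ζ x) :=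
    lintegral_restrict_condFieldK_le_blockDiag_of_bddFluct hK hAs hγ0 hγ hΓ π r hr hrmax hγr zbar hK₂psd h₂ hGm hGsupp
  -- Step 2: the box fields are independent under the comparison field
  have hPform : (Matrix.of fun y y' : ↥(Λ \ Γ) => if π y = π y' then
        A ⟨y, (Finset.mem_sdiff.mp y.2).1⟩ ⟨y', (Finset.mem_sdiff.mp y'.2).1⟩ else 0) =
      (1 : ℝ) • (Matrix.of fun a b : ↥(Λ \ Γ) => if π a = π b then B a b else 0 : Matrix ↥(Λ \ Γ) ↥(Λ \ Γ) ℝ) := by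
    rw [one_smul, hBbd]
  have hvan : ∀ p q, p ≠ q → ∀ s ∈ ((box p : Finset (B1Eq324BenfattoLemma.Site d)) : Set (B1Eq324BenfattoLemma.Site d)),
      ∀ t ∈ ((box q : Finset (B1Eq324BenfattoLemma.Site d)) : Set (B1Eq324BenfattoLemma.Site d)), K₂ s t = 0 := by
    intro p q hpq s hs t ht
    rw [Finset.mem_coe] at hs ht
    refine kernel_blockDiag_eq_zero_of_ne hK₂ hBs π hγ0 one_pos hBγ hPform fun hs' ht' => ?_
    rw [(hbox p ⟨s, hs'⟩).mp hs, (hbox q ⟨t, ht'⟩).mp ht]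
    exact hpq
  have hind := iIndepFun_shift_of_kernel_eq_zero hK₂psd
    (Ω := fun p => ((box p : Finset (B1Eq324BenfattoLemma.Site d)) : Set (B1Eq324BenfattoLemma.Site d))) hvan (condMean K Γ zbar)
  have hind' : iIndepFun (fun p (z : B1Eq324BenfattoLemma.Site d → ℝ) => F p ((box p).restrict z))
      ((gaussianFieldOfKernel K₂).map
        fun (ζ : B1Eq324BenfattoLemma.Site d → ℝ) (x : B1Eq324BenfattoLemma.Site d) => condMean K Γ zbar x + ζ x) :=
    hind.comp (fun p (v : ↥((box p : Finset (B1Eq324BenfattoLemma.Site d)) : Set (B1Eq324BenfattoLemma.Site d)) → ℝ) =>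
        F p (fun j : ↥(box p) => v ⟨(j : B1Eq324BenfattoLemma.Site d), j.2⟩))
      fun p => (hF p).comp (measurable_pi_lambda _ fun j => measurable_pi_apply _)
  have hprod := lintegral_prod_eq_prod_lintegral_of_indepFun Finset.univ
    (fun p (z : B1Eq324BenfattoLemma.Site d → ℝ) => F p ((box p).restrict z)) hind'
    fun p => (hF p).comp (Finset.measurable_restrict (box p))
  -- Step 3: the per-box laws (plain Dirichlet box Gaussians)
  have hlaw : ∀ p, ∫⁻ z, F p ((box p).restrict z) ∂((gaussianFieldOfKernel K₂).map
        fun (ζ : B1Eq324BenfattoLemma.Site d → ℝ) (x : B1Eq324BenfattoLemma.Site d) => condMean K Γ zbar x + ζ x) =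
      ∫⁻ y, F p (ofLp y) ∂multivariateGaussian (toLp 2 ((box p).restrict (condMean K Γ zbar)))
        (A.submatrix (fun j : ↥(box p) => (⟨j, (Finset.mem_sdiff.mp (hboxsub p j.2)).1⟩ : Λ))
            (fun j : ↥(box p) => (⟨j, (Finset.mem_sdiff.mp (hboxsub p j.2)).1⟩ : Λ)))⁻¹ := fun p => by
    rw [lintegral_comp_restrict_shift_window_eq hK₂ hPD π (blockDiag_apply_eq_zero_of_ne π) (hboxsub p)
        (saturated_of_box' π p (hbox p)) (condMean K Γ zbar) (hF p),
      blockDiag_submatrix_box_eq π p (hboxsub p) (hbox p)]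
  calc ∫⁻ z, ∏ p, F p ((box p).restrict z) ∂((gaussianFieldOfKernel (condCov K Γ)).map
          fun (ζ : B1Eq324BenfattoLemma.Site d → ℝ) (x : B1Eq324BenfattoLemma.Site d) => condMean K Γ zbar x + ζ x)
      ≤ ENNReal.ofReal (Real.exp ((∑ y, r y) / (γ - rmax) + T / 2)) *
          ∫⁻ z, ∏ p, F p ((box p).restrict z) ∂((gaussianFieldOfKernel K₂).map
            fun (ζ : B1Eq324BenfattoLemma.Site d → ℝ) (x : B1Eq324BenfattoLemma.Site d) => condMean K Γ zbar x + ζ x) := hdom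
    _ = ENNReal.ofReal (Real.exp ((∑ y, r y) / (γ - rmax) + T / 2)) *
          ∏ p, ∫⁻ z, F p ((box p).restrict z) ∂((gaussianFieldOfKernel K₂).map
            fun (ζ : B1Eq324BenfattoLemma.Site d → ℝ) (x : B1Eq324BenfattoLemma.Site d) => condMean K Γ zbar x + ζ x) := by
        rw [hprod]
    _ = _ := by
        congr 1
        exact Finset.prod_congr rfl fun p _ => hlaw p

/-- **THE CLASS (5.13) AT TEMPERATURE ZERO, lower**: with the same data and the same support condition,
`e^{−(ρ+T/2)} · Π_p ∫⁻ F_p dN(u_Γ(z̄)|_{box p}, (A|_{box p})⁻¹) ≤ ∫⁻ Π_p F_p(z|_{box p}) dP̄^K_{Γ,z̄}` — the SAME product measure as in the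
upper bound, so that a pavement step can go down and come back up through one family of box Gaussians.
[cite: BenfattoEtAl1978, §5 (5.13) p.155, (5.15) p.155 (class substitute at temperature zero; ours)] -/
theorem exp_mul_prod_dirichlet_le_lintegral_prod_restrict_condFieldK {σ : Type*} [Fintype σ] [DecidableEq σ]
    (hAs : ∀ e e', A e e' = A e' e) {γ rmax : ℝ} (hγ0 : 0 < γ)
    (hγ : ∀ x : Λ → ℝ, γ * ∑ e, x e ^ 2 ≤ ∑ e, ∑ e', A e e' * x e * x e')
    {Γ : Finset (B1Eq324BenfattoLemma.Site d)} (hΓ : Γ ⊆ Λ) (π : ↥(Λ \ Γ) → σ) (r : ↥(Λ \ Γ) → ℝ)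
    (hr : ∀ y : ↥(Λ \ Γ), ∑ y' : ↥(Λ \ Γ), (if π y = π y' then (0 : ℝ) else
      |A ⟨y, (Finset.mem_sdiff.mp y.2).1⟩ ⟨y', (Finset.mem_sdiff.mp y'.2).1⟩|) ≤ r y)
    (hrmax : ∀ y, r y ≤ rmax) (hγr : rmax < γ) (zbar : B1Eq324BenfattoLemma.Site d → ℝ)
    (box : σ → Finset (B1Eq324BenfattoLemma.Site d)) (hboxsub : ∀ p, box p ⊆ Λ \ Γ)
    (hbox : ∀ p (y : ↥(Λ \ Γ)), (y : B1Eq324BenfattoLemma.Site d) ∈ box p ↔ π y = p)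
    {F : (p : σ) → (↥(box p) → ℝ) → ℝ≥0∞} (hF : ∀ p, Measurable (F p)) {T : ℝ}
    (hsupp : ∀ z : B1Eq324BenfattoLemma.Site d → ℝ, (∀ p, F p ((box p).restrict z) ≠ 0) →
      ∑ y : ↥(Λ \ Γ), r y * (z y - condMean K Γ zbar y) ^ 2 ≤ T) :
    ENNReal.ofReal (Real.exp (-((∑ y, r y) / (γ - rmax) + T / 2))) *
        ∏ p, ∫⁻ y, F p (ofLp y) ∂multivariateGaussian (toLp 2 ((box p).restrict (condMean K Γ zbar)))
          (A.submatrix (fun j : ↥(box p) => (⟨j, (Finset.mem_sdiff.mp (hboxsub p j.2)).1⟩ : Λ))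
              (fun j : ↥(box p) => (⟨j, (Finset.mem_sdiff.mp (hboxsub p j.2)).1⟩ : Λ)))⁻¹ ≤
      ∫⁻ z, ∏ p, F p ((box p).restrict z) ∂((gaussianFieldOfKernel (condCov K Γ)).map
        fun (ζ : B1Eq324BenfattoLemma.Site d → ℝ) (x : B1Eq324BenfattoLemma.Site d) => condMean K Γ zbar x + ζ x) := by
  classical
  set B : Matrix ↥(Λ \ Γ) ↥(Λ \ Γ) ℝ := A.submatrix (fun j : ↥(Λ \ Γ) => (⟨j, (Finset.mem_sdiff.mp j.2).1⟩ : Λ))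
    (fun j : ↥(Λ \ Γ) => (⟨j, (Finset.mem_sdiff.mp j.2).1⟩ : Λ)) with hB
  have hBs : ∀ y y', B y y' = B y' y := fun y y' => hAs _ _
  have hBγ : ∀ v : ↥(Λ \ Γ) → ℝ, γ * ∑ y, v y ^ 2 ≤ ∑ y, ∑ y', B y y' * v y * v y' := coercive_submatrix_sdiff hγ Γ
  have hBbd : (Matrix.of fun y y' : ↥(Λ \ Γ) => if π y = π y' then
        A ⟨y, (Finset.mem_sdiff.mp y.2).1⟩ ⟨y', (Finset.mem_sdiff.mp y'.2).1⟩ else 0) =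
      (Matrix.of fun y y' : ↥(Λ \ Γ) => if π y = π y' then B y y' else 0 : Matrix ↥(Λ \ Γ) ↥(Λ \ Γ) ℝ) := by
    ext y y'
    simp only [Matrix.of_apply, hB, Matrix.submatrix_apply]
  have hPD : (Matrix.of fun y y' : ↥(Λ \ Γ) => if π y = π y' then
      A ⟨y, (Finset.mem_sdiff.mp y.2).1⟩ ⟨y', (Finset.mem_sdiff.mp y'.2).1⟩ else 0).PosDef := by
    rw [hBbd]
    exact posDef_blockDiag hBs π hγ0 hBγ
  set K₂ : B1Eq324BenfattoLemma.Site d → B1Eq324BenfattoLemma.Site d → ℝ := fun x y =>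
    if h : x ∈ Λ \ Γ ∧ y ∈ Λ \ Γ then
      (((Matrix.of fun y y' : ↥(Λ \ Γ) => if π y = π y' then
          A ⟨y, (Finset.mem_sdiff.mp y.2).1⟩ ⟨y', (Finset.mem_sdiff.mp y'.2).1⟩ else 0)⁻¹ :
        Matrix ↥(Λ \ Γ) ↥(Λ \ Γ) ℝ) ⟨x, h.1⟩ ⟨y, h.2⟩) else 0 with hK₂def
  have hK₂ : ∀ x y, K₂ x y = if h : x ∈ Λ \ Γ ∧ y ∈ Λ \ Γ then
      (((Matrix.of fun y y' : ↥(Λ \ Γ) => if π y = π y' then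
          A ⟨y, (Finset.mem_sdiff.mp y.2).1⟩ ⟨y', (Finset.mem_sdiff.mp y'.2).1⟩ else 0)⁻¹ :
        Matrix ↥(Λ \ Γ) ↥(Λ \ Γ) ℝ) ⟨x, h.1⟩ ⟨y, h.2⟩) else 0 := fun x y => rfl
  have hK₂psd : IsPosSemidefKernel K₂ := isPosSemidefKernel_kernel hK₂ hPD
  have h₂ := covGram_kernel_eq_inv hK₂
  have hGm : Measurable (fun v : ↥(Λ \ Γ) → ℝ => ∏ p, F p (fun j : ↥(box p) => v ⟨j, hboxsub p j.2⟩)) :=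
    Finset.measurable_prod (f := fun p (v : ↥(Λ \ Γ) → ℝ) => F p (fun j : ↥(box p) => v ⟨j, hboxsub p j.2⟩)) Finset.univ
      fun p _ => (hF p).comp (measurable_pi_lambda _ fun j => measurable_pi_apply _)
  have hGsupp : ∀ v : ↥(Λ \ Γ) → ℝ, (∏ p, F p (fun j : ↥(box p) => v ⟨j, hboxsub p j.2⟩)) ≠ 0 →
      ∑ y : ↥(Λ \ Γ), r y * (v y - condMean K Γ zbar (y : B1Eq324BenfattoLemma.Site d)) ^ 2 ≤ T := by
    intro v hv
    have hz := hsupp (fun x => if h : x ∈ Λ \ Γ then v ⟨x, h⟩ else 0) fun p => by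
      have hrestr : (box p).restrict (fun x => if h : x ∈ Λ \ Γ then v ⟨x, h⟩ else 0) =
          fun j : ↥(box p) => v ⟨j, hboxsub p j.2⟩ := by
        funext j
        exact dif_pos (hboxsub p j.2)
      rw [hrestr]
      exact (Finset.prod_ne_zero_iff.mp hv) p (Finset.mem_univ p)
    have hzv : ∀ y : ↥(Λ \ Γ), (fun x => if h : x ∈ Λ \ Γ then v ⟨x, h⟩ else 0) (y : B1Eq324BenfattoLemma.Site d) = v y :=
      fun y => by simp only [dif_pos y.2]
    simpa only [hzv] using hz
  have hdom : ENNReal.ofReal (Real.exp (-((∑ y, r y) / (γ - rmax) + T / 2))) *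
        ∫⁻ z, ∏ p, F p ((box p).restrict z) ∂((gaussianFieldOfKernel K₂).map
          fun (ζ : B1Eq324BenfattoLemma.Site d → ℝ) (x : B1Eq324BenfattoLemma.Site d) => condMean K Γ zbar x + ζ x) ≤
      ∫⁻ z, ∏ p, F p ((box p).restrict z) ∂((gaussianFieldOfKernel (condCov K Γ)).map
        fun (ζ : B1Eq324BenfattoLemma.Site d → ℝ) (x : B1Eq324BenfattoLemma.Site d) => condMean K Γ zbar x + ζ x) :=
    lintegral_restrict_condFieldK_ge_blockDiag_of_bddFluct hK hAs hγ0 hγ hΓ π r hr hrmax hγr zbar hK₂psd h₂ hGm hGsupp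
  have hPform : (Matrix.of fun y y' : ↥(Λ \ Γ) => if π y = π y' then
        A ⟨y, (Finset.mem_sdiff.mp y.2).1⟩ ⟨y', (Finset.mem_sdiff.mp y'.2).1⟩ else 0) =
      (1 : ℝ) • (Matrix.of fun a b : ↥(Λ \ Γ) => if π a = π b then B a b else 0 : Matrix ↥(Λ \ Γ) ↥(Λ \ Γ) ℝ) := by
    rw [one_smul, hBbd]
  have hvan : ∀ p q, p ≠ q → ∀ s ∈ ((box p : Finset (B1Eq324BenfattoLemma.Site d)) : Set (B1Eq324BenfattoLemma.Site d)),
      ∀ t ∈ ((box q : Finset (B1Eq324BenfattoLemma.Site d)) : Set (B1Eq324BenfattoLemma.Site d)), K₂ s t = 0 := by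
    intro p q hpq s hs t ht
    rw [Finset.mem_coe] at hs ht
    refine kernel_blockDiag_eq_zero_of_ne hK₂ hBs π hγ0 one_pos hBγ hPform fun hs' ht' => ?_
    rw [(hbox p ⟨s, hs'⟩).mp hs, (hbox q ⟨t, ht'⟩).mp ht]
    exact hpq
  have hind := iIndepFun_shift_of_kernel_eq_zero hK₂psd
    (Ω := fun p => ((box p : Finset (B1Eq324BenfattoLemma.Site d)) : Set (B1Eq324BenfattoLemma.Site d))) hvan (condMean K Γ zbar)
  have hind' : iIndepFun (fun p (z : B1Eq324BenfattoLemma.Site d → ℝ) => F p ((box p).restrict z))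
      ((gaussianFieldOfKernel K₂).map
        fun (ζ : B1Eq324BenfattoLemma.Site d → ℝ) (x : B1Eq324BenfattoLemma.Site d) => condMean K Γ zbar x + ζ x) :=
    hind.comp (fun p (v : ↥((box p : Finset (B1Eq324BenfattoLemma.Site d)) : Set (B1Eq324BenfattoLemma.Site d)) → ℝ) =>
        F p (fun j : ↥(box p) => v ⟨(j : B1Eq324BenfattoLemma.Site d), j.2⟩))
      fun p => (hF p).comp (measurable_pi_lambda _ fun j => measurable_pi_apply _)
  have hprod := lintegral_prod_eq_prod_lintegral_of_indepFun Finset.univ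
    (fun p (z : B1Eq324BenfattoLemma.Site d → ℝ) => F p ((box p).restrict z)) hind'
    fun p => (hF p).comp (Finset.measurable_restrict (box p))
  have hlaw : ∀ p, ∫⁻ z, F p ((box p).restrict z) ∂((gaussianFieldOfKernel K₂).map
        fun (ζ : B1Eq324BenfattoLemma.Site d → ℝ) (x : B1Eq324BenfattoLemma.Site d) => condMean K Γ zbar x + ζ x) =
      ∫⁻ y, F p (ofLp y) ∂multivariateGaussian (toLp 2 ((box p).restrict (condMean K Γ zbar)))
        (A.submatrix (fun j : ↥(box p) => (⟨j, (Finset.mem_sdiff.mp (hboxsub p j.2)).1⟩ : Λ))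
            (fun j : ↥(box p) => (⟨j, (Finset.mem_sdiff.mp (hboxsub p j.2)).1⟩ : Λ)))⁻¹ := fun p => by
    rw [lintegral_comp_restrict_shift_window_eq hK₂ hPD π (blockDiag_apply_eq_zero_of_ne π) (hboxsub p)
        (saturated_of_box' π p (hbox p)) (condMean K Γ zbar) (hF p),
      blockDiag_submatrix_box_eq π p (hboxsub p) (hbox p)]
  calc ENNReal.ofReal (Real.exp (-((∑ y, r y) / (γ - rmax) + T / 2))) *
        ∏ p, ∫⁻ y, F p (ofLp y) ∂multivariateGaussian (toLp 2 ((box p).restrict (condMean K Γ zbar)))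
          (A.submatrix (fun j : ↥(box p) => (⟨j, (Finset.mem_sdiff.mp (hboxsub p j.2)).1⟩ : Λ))
              (fun j : ↥(box p) => (⟨j, (Finset.mem_sdiff.mp (hboxsub p j.2)).1⟩ : Λ)))⁻¹
      = ENNReal.ofReal (Real.exp (-((∑ y, r y) / (γ - rmax) + T / 2))) *
          ∏ p, ∫⁻ z, F p ((box p).restrict z) ∂((gaussianFieldOfKernel K₂).map
            fun (ζ : B1Eq324BenfattoLemma.Site d → ℝ) (x : B1Eq324BenfattoLemma.Site d) => condMean K Γ zbar x + ζ x) := by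
        congr 1
        exact Finset.prod_congr rfl fun p _ => (hlaw p).symm
    _ = ENNReal.ofReal (Real.exp (-((∑ y, r y) / (γ - rmax) + T / 2))) *
          ∫⁻ z, ∏ p, F p ((box p).restrict z) ∂((gaussianFieldOfKernel K₂).map
            fun (ζ : B1Eq324BenfattoLemma.Site d → ℝ) (x : B1Eq324BenfattoLemma.Site d) => condMean K Γ zbar x + ζ x) := by
        rw [hprod]
    _ ≤ _ := hdom

end Boxes

end Literature.MathematicalPhysics.QuantumFieldTheory.Balaban1983to89.B1Eq324BenfattoKernelComparisonBounded

end
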